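import Mathlib
import Summits.NavierStokesRegularity.NavierStokesRegularity.Theorems.EulerZoomLiouvillePowerGaugeEulerLiouvilleDSSNodeSpectralDominated
import HarnessLib.Audit

/-!
# Crux E `PowerGaugeEulerLiouville` (stmt-NavierStokesRegularity-19832): SPECTRAL GROWTH TOOLS FOR THE PERIOD MAP — Bezout projection bounds, the
# «contracting line under an expanding complex pair» splitting, and the growth of `M^k` when the cofactor pair is complex
# (width seat ns-cas-k2 g3, lane «DSS thin vortical nodes», tool E part 1)

Route `EulerZoomLiouville` (NavierStokesRegularity), crux E.  Linear algebra on `ℝ³` complementing `…DSSNodeSpectral{Splitting,Rates,Dominated}` for the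
trichotomy «every permanent node is thin or kills»:
* `exists_bezout_decomposition` — under `(M − λ)(M² + βM + γ₀) = 0`, `λ² + βλ + γ₀ ≠ 0`: every `x = x₁ + x₂`, `x₁ ∈ ker(M² + βM + γ₀)`, `x₂ ∈ ker(M − λ)`,
  with `‖x₁‖, ‖x₂‖ ≤ K‖x‖` for one constant `K`;
* `le_norm_pow_of_complexPair` — on `ker(M² + uM + w)` with `u² < 4w`: `‖M^k x‖ ≥ (√w)^k‖x‖/√C₂` (the adapted form from below);
* **`exists_splitting_of_expandingPair`** — `Mv = λv` (`v ≠ 0`, `0 ≤ λ < 1`... precisely `|λ| < 1`), cofactor complex with `√w > |λ|`... : DOMINATED SPLITTING with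
  `Es = ker(M − λ)` (contracting line) and `Ec = ker(M² + uM + w)` (the plane of the pair), in the shape consumed by `addHaar_pastHistorySet_eq_zero_of_dominated_pow`;
* **`norm_pow_le_of_complexPair_global`** — if moreover `√w ≤ s` and `|λ| ≤ s`, then `‖M^k x‖ ≤ C·s^k·‖x‖` on ALL of `ℝ³`.

WHAT THIS IS NOT: not NS regularity, not the crux E — finite-dimensional linear algebra for hypothetical DSS blow-up members; 19832 is OPEN. [folklore]
-/

noncomputable section

set_option linter.dupNamespace false

open Set Filter Topology Function
open scoped RealInnerProductSpace

namespace Summit.NavierStokesRegularity.NavierStokesRegularity.Theorems.PowerGaugeEulerLiouville.DSSNodes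

/-! ### Bezout decomposition with norm bounds -/

/-- **Bezout decomposition with bounds.**  `(M − λ)∘(M² + βM + γ₀) = 0`, `c = λ² + βλ + γ₀ ≠ 0`: `x = x₁ + x₂` with `x₁ ∈ ker(M² + βM + γ₀)`,
`x₂ = c⁻¹(M²x + βMx + γ₀x) ∈ ker(M − λ)`, and `‖x₁‖, ‖x₂‖ ≤ K‖x‖`. [folklore] -/
theorem exists_bezout_decomposition (M : EuclideanSpace ℝ (Fin 3) →L[ℝ] EuclideanSpace ℝ (Fin 3)) (β γ₀ lam : ℝ)
    (hzero : ∀ x, M (M (M x) + β • M x + γ₀ • x) - lam • (M (M x) + β • M x + γ₀ • x) = 0)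
    (hc : lam ^ 2 + β * lam + γ₀ ≠ 0) :
    ∃ K : ℝ, 0 ≤ K ∧ ∀ x : EuclideanSpace ℝ (Fin 3), ∃ x₁ x₂ : EuclideanSpace ℝ (Fin 3), x = x₁ + x₂ ∧
      M (M x₁) + β • M x₁ + γ₀ • x₁ = 0 ∧ M x₂ = lam • x₂ ∧ ‖x₁‖ ≤ K * ‖x‖ ∧ ‖x₂‖ ≤ K * ‖x‖ := by
  set c : ℝ := lam ^ 2 + β * lam + γ₀ with hcdef
  set K₂ : ℝ := |c|⁻¹ * (‖M‖ * ‖M‖ + |β| * ‖M‖ + |γ₀|) with hK₂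
  have hK₂0 : 0 ≤ K₂ := by positivity
  refine ⟨1 + K₂, by positivity, fun x => ?_⟩
  set x₂ : EuclideanSpace ℝ (Fin 3) := c⁻¹ • (M (M x) + β • M x + γ₀ • x) with hx₂
  refine ⟨x - x₂, x₂, by abel, ?_, ?_, ?_, ?_⟩
  · -- `x − x₂ ∈ ker G`: `G x − c⁻¹ G(Gx)` and `G(Gx) = c·Gx` since `Gx ∈ ker(M − λ)`
    have hMG : M (M (M x) + β • M x + γ₀ • x) = lam • (M (M x) + β • M x + γ₀ • x) := sub_eq_zero.1 (hzero x)
    set g := M (M x) + β • M x + γ₀ • x with hg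
    have hGG : M (M g) + β • M g + γ₀ • g = c • g := by
      rw [hMG, map_smul, hMG, smul_smul, hcdef]; module
    have e : M (M (x - x₂)) + β • M (x - x₂) + γ₀ • (x - x₂) = g - c⁻¹ • (M (M g) + β • M g + γ₀ • g) := by
      simp only [hx₂, map_sub, map_smul, hg]; module
    rw [e, hGG, smul_smul, inv_mul_cancel₀ hc, one_smul, sub_self]
  · rw [hx₂, map_smul, sub_eq_zero.1 (hzero x), smul_comm]
  · have h2 : ‖x₂‖ ≤ K₂ * ‖x‖ := by
      rw [hx₂, norm_smul, Real.norm_eq_abs, abs_inv, hK₂, mul_assoc]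
      refine mul_le_mul_of_nonneg_left ?_ (by positivity)
      calc ‖M (M x) + β • M x + γ₀ • x‖ ≤ ‖M (M x)‖ + ‖β • M x‖ + ‖γ₀ • x‖ := norm_add₃_le
        _ ≤ ‖M‖ * (‖M‖ * ‖x‖) + |β| * (‖M‖ * ‖x‖) + |γ₀| * ‖x‖ := by
            rw [norm_smul, norm_smul, Real.norm_eq_abs, Real.norm_eq_abs]
            exact add_le_add (add_le_add ((M.le_opNorm _).trans (mul_le_mul_of_nonneg_left (M.le_opNorm x) (norm_nonneg _)))
              (mul_le_mul_of_nonneg_left (M.le_opNorm x) (abs_nonneg _))) le_rfl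
        _ = (‖M‖ * ‖M‖ + |β| * ‖M‖ + |γ₀|) * ‖x‖ := by ring
    calc ‖x - x₂‖ ≤ ‖x‖ + ‖x₂‖ := norm_sub_le _ _
      _ ≤ ‖x‖ + K₂ * ‖x‖ := by linarith
      _ = (1 + K₂) * ‖x‖ := by ring
  · rw [hx₂, norm_smul, Real.norm_eq_abs, abs_inv]
    calc |c|⁻¹ * ‖M (M x) + β • M x + γ₀ • x‖ ≤ |c|⁻¹ * ((‖M‖ * ‖M‖ + |β| * ‖M‖ + |γ₀|) * ‖x‖) := by
          refine mul_le_mul_of_nonneg_left ?_ (by positivity)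
          calc ‖M (M x) + β • M x + γ₀ • x‖ ≤ ‖M (M x)‖ + ‖β • M x‖ + ‖γ₀ • x‖ := norm_add₃_le
            _ ≤ ‖M‖ * (‖M‖ * ‖x‖) + |β| * (‖M‖ * ‖x‖) + |γ₀| * ‖x‖ := by
                rw [norm_smul, norm_smul, Real.norm_eq_abs, Real.norm_eq_abs]
                exact add_le_add (add_le_add ((M.le_opNorm _).trans (mul_le_mul_of_nonneg_left (M.le_opNorm x) (norm_nonneg _)))
                  (mul_le_mul_of_nonneg_left (M.le_opNorm x) (abs_nonneg _))) le_rfl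
            _ = (‖M‖ * ‖M‖ + |β| * ‖M‖ + |γ₀|) * ‖x‖ := by ring
      _ = K₂ * ‖x‖ := by rw [hK₂]; ring
      _ ≤ (1 + K₂) * ‖x‖ := by nlinarith [norm_nonneg x]

/-! ### Complex pair: the adapted form from below -/

/-- **COMPLEX PAIR, LOWER RATE.**  `u² < 4w`, `x ∈ ker(M² + uM + w)` ⇒ `(√w)^k‖x‖ ≤ √(1 + (‖M‖ + |u|/2)²/(w − u²/4)) · ‖M^k x‖`. [folklore] -/
theorem le_norm_pow_of_complexPair (M : EuclideanSpace ℝ (Fin 3) →L[ℝ] EuclideanSpace ℝ (Fin 3)) {u w : ℝ} (hΔ : u ^ 2 < 4 * w)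
    {x : EuclideanSpace ℝ (Fin 3)} (hx : M (M x) + u • M x + w • x = 0) (k : ℕ) :
    Real.sqrt w ^ k * ‖x‖ ≤ Real.sqrt (1 + (‖M‖ + |u| / 2) ^ 2 / (w - u ^ 2 / 4)) * ‖(M ^ k) x‖ := by
  have hδ : 0 < w - u ^ 2 / 4 := by linarith
  have hw0 : 0 < w := by nlinarith [sq_nonneg u]
  -- the form along the orbit: `N(M^k x) = w^k N(x)`
  have hstep : ∀ j : ℕ, M (M ((M ^ j) x)) + u • M ((M ^ j) x) + w • (M ^ j) x = 0 ∧
      ‖(M ^ j) x‖ ^ 2 + (w - u ^ 2 / 4)⁻¹ * ‖M ((M ^ j) x) + (u / 2) • (M ^ j) x‖ ^ 2 =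
        w ^ j * (‖x‖ ^ 2 + (w - u ^ 2 / 4)⁻¹ * ‖M x + (u / 2) • x‖ ^ 2) := by
    intro j
    induction j with
    | zero => exact ⟨by simpa using hx, by simp⟩
    | succ j ih =>
        obtain ⟨hker, hN⟩ := ih
        refine ⟨?_, ?_⟩
        · rw [pow_succ_apply']
          have h := congrArg M hker
          rw [map_zero] at h
          rw [← h]
          simp only [map_add, map_smul]
        · rw [pow_succ_apply', adaptedForm_step M hΔ hker, hN, pow_succ]
          ring
  obtain ⟨_, hN⟩ := hstep k
  set C2 : ℝ := 1 + (‖M‖ + |u| / 2) ^ 2 / (w - u ^ 2 / 4) with hC2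
  set y := (M ^ k) x with hy
  -- `N(y) ≤ C2 ‖y‖²`
  have hJ : ‖M y + (u / 2) • y‖ ≤ (‖M‖ + |u| / 2) * ‖y‖ := by
    calc ‖M y + (u / 2) • y‖ ≤ ‖M y‖ + ‖(u / 2) • y‖ := norm_add_le _ _
      _ ≤ ‖M‖ * ‖y‖ + |u| / 2 * ‖y‖ := by
          rw [norm_smul, Real.norm_eq_abs, abs_div, abs_two]
          exact add_le_add (M.le_opNorm y) le_rfl
      _ = (‖M‖ + |u| / 2) * ‖y‖ := by ring
  have hNy : ‖y‖ ^ 2 + (w - u ^ 2 / 4)⁻¹ * ‖M y + (u / 2) • y‖ ^ 2 ≤ C2 * ‖y‖ ^ 2 := by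
    have h1 : ‖M y + (u / 2) • y‖ ^ 2 ≤ ((‖M‖ + |u| / 2) * ‖y‖) ^ 2 := pow_le_pow_left₀ (norm_nonneg _) hJ 2
    have h2 : (w - u ^ 2 / 4)⁻¹ * ‖M y + (u / 2) • y‖ ^ 2 ≤ (w - u ^ 2 / 4)⁻¹ * ((‖M‖ + |u| / 2) * ‖y‖) ^ 2 :=
      mul_le_mul_of_nonneg_left h1 (inv_nonneg.2 hδ.le)
    rw [hC2]
    have e : (1 + (‖M‖ + |u| / 2) ^ 2 / (w - u ^ 2 / 4)) * ‖y‖ ^ 2 =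
        ‖y‖ ^ 2 + (w - u ^ 2 / 4)⁻¹ * ((‖M‖ + |u| / 2) * ‖y‖) ^ 2 := by
      field_simp
    rw [e]
    linarith
  -- `w^k ‖x‖² ≤ N(y)`
  have hlow : w ^ k * ‖x‖ ^ 2 ≤ ‖y‖ ^ 2 + (w - u ^ 2 / 4)⁻¹ * ‖M y + (u / 2) • y‖ ^ 2 := by
    rw [hy, hN]
    have h3 : 0 ≤ (w - u ^ 2 / 4)⁻¹ * ‖M x + (u / 2) • x‖ ^ 2 := by positivity
    nlinarith [pow_nonneg hw0.le k]
  have hsq : (Real.sqrt w ^ k * ‖x‖) ^ 2 ≤ (Real.sqrt C2 * ‖y‖) ^ 2 := by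
    have hC20 : 0 ≤ C2 := by rw [hC2]; positivity
    rw [mul_pow, mul_pow, Real.sq_sqrt hC20, ← pow_mul, mul_comm k 2, pow_mul, Real.sq_sqrt hw0.le]
    linarith
  have hnn : 0 ≤ Real.sqrt C2 * ‖y‖ := by positivity
  exact (pow_le_pow_iff_left₀ (by positivity) hnn two_ne_zero).1 hsq

/-! ### A contracting eigenline under an expanding complex pair -/

/-- **SPLITTING: CONTRACTING LINE, EXPANDING COMPLEX PAIR.**  `Mv = λv` (`v ≠ 0`, `|λ| < 1`), the cofactor `X² + uX + w` of `λ` is complex (`u² < 4w`) with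
`(M − λ)(M² + uM + w) = 0` and `√w > |λ|`... and `1 ≤ w` (so the pair does not contract): then `Es = ker(M − λ)`, `Ec = ker(M² + uM + w)` is a dominated
splitting of a power in the shape of `addHaar_pastHistorySet_eq_zero_of_dominated_pow`. [folklore] -/
theorem exists_splitting_of_expandingPair (M : EuclideanSpace ℝ (Fin 3) →L[ℝ] EuclideanSpace ℝ (Fin 3)) {lam u w : ℝ}
    {v : EuclideanSpace ℝ (Fin 3)} (hv : v ≠ 0) (hMv : M v = lam • v) (hlam : |lam| < 1) (hC : u ^ 2 < 4 * w) (hw1 : 1 ≤ w)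
    (hzero : ∀ x, M (M (M x) + u • M x + w • x) - lam • (M (M x) + u • M x + w • x) = 0) :
    ∃ (Es Ec : Submodule ℝ (EuclideanSpace ℝ (Fin 3))) (k : ℕ) (a b : ℝ), IsCompl Es Ec ∧ (∀ x ∈ Es, M x ∈ Es) ∧
      (∀ x ∈ Ec, M x ∈ Ec) ∧ Ec ≠ ⊤ ∧ 0 < k ∧ a < 1 ∧ a < b ∧ (∀ x ∈ Es, ‖(M ^ k) x‖ ≤ a * ‖x‖) ∧
      (∀ x ∈ Ec, b * ‖x‖ ≤ ‖(M ^ k) x‖) := by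
  have hw0 : 0 < w := by linarith
  have hc : lam ^ 2 + u * lam + w ≠ 0 := by nlinarith [sq_nonneg (lam + u / 2)]
  have hcompl := (isCompl_ker_quadratic_ker_linear M u w lam hzero hc).symm
  set Es := LinearMap.ker ((M - lam • ContinuousLinearMap.id ℝ (EuclideanSpace ℝ (Fin 3)) :
        EuclideanSpace ℝ (Fin 3) →L[ℝ] EuclideanSpace ℝ (Fin 3)) : EuclideanSpace ℝ (Fin 3) →ₗ[ℝ] EuclideanSpace ℝ (Fin 3))
    with hEs
  set Ec := LinearMap.ker ((M.comp M + u • M + w • ContinuousLinearMap.id ℝ (EuclideanSpace ℝ (Fin 3)) :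
        EuclideanSpace ℝ (Fin 3) →L[ℝ] EuclideanSpace ℝ (Fin 3)) : EuclideanSpace ℝ (Fin 3) →ₗ[ℝ] EuclideanSpace ℝ (Fin 3))
    with hEc
  have hEsne : Es ≠ ⊥ := by
    rw [Submodule.ne_bot_iff]
    exact ⟨v, (mem_ker_linear_iff M lam v).2 hMv, hv⟩
  -- rates: `a = |λ|^k`, `b = (√w)^k / √C₂`
  set C₂ : ℝ := Real.sqrt (1 + (‖M‖ + |u| / 2) ^ 2 / (w - u ^ 2 / 4)) with hC₂
  have hδ : 0 < w - u ^ 2 / 4 := by linarith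
  have hC₂1 : 1 ≤ C₂ := by
    rw [hC₂]
    calc (1 : ℝ) = Real.sqrt 1 := Real.sqrt_one.symm
      _ ≤ Real.sqrt (1 + (‖M‖ + |u| / 2) ^ 2 / (w - u ^ 2 / 4)) := Real.sqrt_le_sqrt (by
          have : 0 ≤ (‖M‖ + |u| / 2) ^ 2 / (w - u ^ 2 / 4) := by positivity
          linarith)
  have hC₂0 : 0 < C₂ := by linarith
  have hsw1 : 1 ≤ Real.sqrt w := by rw [← Real.sqrt_one]; exact Real.sqrt_le_sqrt hw1
  -- `θ = |λ|`, `(|λ|)^k · C₂ < (√w)^k` eventually since `|λ| < 1 ≤ √w`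
  have hlim : Tendsto (fun k : ℕ => C₂ * |lam| ^ k) atTop (𝓝 0) := by
    simpa using (tendsto_pow_atTop_nhds_zero_of_lt_one (abs_nonneg lam) hlam).const_mul C₂
  obtain ⟨k, hk1, hk⟩ := exists_ge_one_lt_one_of_tendsto hlim
  have hswk : 1 ≤ Real.sqrt w ^ k := one_le_pow₀ hsw1
  refine ⟨Es, Ec, k, |lam| ^ k, Real.sqrt w ^ k / C₂, hcompl, fun x hx => mem_ker_linear_of_mem M lam hx,
    fun x hx => mem_ker_quadratic_of_mem M u w hx, ne_top_of_isCompl_of_ne_bot hcompl hEsne, hk1,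
    pow_lt_one₀ (abs_nonneg _) hlam (by omega), ?_, fun x hx => ?_, fun x hx => ?_⟩
  · -- `|λ|^k < (√w)^k / C₂` from `C₂ |λ|^k < 1 ≤ (√w)^k`
    rw [lt_div_iff₀ hC₂0]
    nlinarith
  · exact (norm_pow_of_mem_ker_linear M hx k).le
  · rw [div_mul_eq_mul_div, div_le_iff₀ hC₂0]
    have h := le_norm_pow_of_complexPair M hC ((mem_ker_quadratic_iff M u w x).1 hx) k
    rw [← hC₂] at h
    linarith

/-! ### Growth of `M^k` when the cofactor pair is complex -/

/-- **GROWTH, COMPLEX PAIR.**  `(M − λ)(M² + uM + w) = 0`, `u² < 4w`, `√w ≤ s`, `|λ| ≤ s`: then `‖M^k x‖ ≤ C·s^k·‖x‖` for all `x ∈ ℝ³`, `k`. [folklore] -/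
theorem norm_pow_le_of_complexPair_global (M : EuclideanSpace ℝ (Fin 3) →L[ℝ] EuclideanSpace ℝ (Fin 3)) {lam u w s : ℝ}
    (hC : u ^ 2 < 4 * w) (hws : Real.sqrt w ≤ s) (hls : |lam| ≤ s)
    (hzero : ∀ x, M (M (M x) + u • M x + w • x) - lam • (M (M x) + u • M x + w • x) = 0) :
    ∃ C : ℝ, 0 ≤ C ∧ ∀ (k : ℕ) (x : EuclideanSpace ℝ (Fin 3)), ‖(M ^ k) x‖ ≤ C * s ^ k * ‖x‖ := by
  have hw0 : 0 < w := by nlinarith [sq_nonneg u]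
  have hs0 : 0 ≤ s := (abs_nonneg lam).trans hls
  have hc : lam ^ 2 + u * lam + w ≠ 0 := by nlinarith [sq_nonneg (lam + u / 2)]
  obtain ⟨K, hK0, hdec⟩ := exists_bezout_decomposition M u w lam hzero hc
  set C₁ : ℝ := Real.sqrt (1 + (‖M‖ + |u| / 2) ^ 2 / (w - u ^ 2 / 4)) with hC₁
  have hC₁0 : 0 ≤ C₁ := Real.sqrt_nonneg _
  refine ⟨(C₁ + 1) * K, by positivity, fun k x => ?_⟩
  obtain ⟨x₁, x₂, hx, hx₁, hx₂, hn₁, hn₂⟩ := hdec x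
  have h1 : ‖(M ^ k) x₁‖ ≤ C₁ * Real.sqrt w ^ k * ‖x₁‖ := norm_pow_le_of_complexPair M hC hx₁ k
  have h2 : ‖(M ^ k) x₂‖ = |lam| ^ k * ‖x₂‖ := by
    rw [pow_apply_of_eigen M hx₂ k, norm_smul, Real.norm_eq_abs, abs_pow]
  have hwk : Real.sqrt w ^ k ≤ s ^ k := pow_le_pow_left₀ (Real.sqrt_nonneg _) hws k
  have hlk : |lam| ^ k ≤ s ^ k := pow_le_pow_left₀ (abs_nonneg _) hls k
  calc ‖(M ^ k) x‖ = ‖(M ^ k) x₁ + (M ^ k) x₂‖ := by rw [hx, map_add]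
    _ ≤ ‖(M ^ k) x₁‖ + ‖(M ^ k) x₂‖ := norm_add_le _ _
    _ ≤ C₁ * Real.sqrt w ^ k * ‖x₁‖ + |lam| ^ k * ‖x₂‖ := by rw [h2]; linarith
    _ ≤ C₁ * s ^ k * (K * ‖x‖) + s ^ k * (K * ‖x‖) := by
        have a1 : C₁ * Real.sqrt w ^ k * ‖x₁‖ ≤ C₁ * s ^ k * (K * ‖x‖) :=
          mul_le_mul (mul_le_mul_of_nonneg_left hwk hC₁0) hn₁ (norm_nonneg _) (by positivity)
        have a2 : |lam| ^ k * ‖x₂‖ ≤ s ^ k * (K * ‖x‖) := mul_le_mul hlk hn₂ (norm_nonneg _) (by positivity)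
        linarith
    _ = (C₁ + 1) * K * s ^ k * ‖x‖ := by ring

end Summit.NavierStokesRegularity.NavierStokesRegularity.Theorems.PowerGaugeEulerLiouville.DSSNodes

end
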